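import Summits.RiemannHypothesis.RiemannHypothesis.Theses.IntegerScrew
import Summits.RiemannHypothesis.RiemannHypothesis.Theorems.EtaLeadingQuarterEtaLeadingSecondMoment
import Summits.RiemannHypothesis.RiemannHypothesis.Theorems.EtaLeadingQuarterWeakLockingLayer
import Summits.RiemannHypothesis.RiemannHypothesis.Theorems.EtaLeadingQuarterQuarterTrialVectors
import HarnessLib

/-!
# Rung S-P(P1) leaf `ScrewFloorLimsupQuarter` (item stmt-RiemannHypothesis-19328) — glue closer

`∀ ε > 0, ∀ᶠ M in atTop, screwFloor M ≤ 1/4 + ε` (THEOREM A of TRIAL-BOUND-THEOREM.md, the leading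
order `limsup_M c(M) ≤ 1/4` of the integer-screw floor).  RH-FREE statement.  Proof = pure glue: the
deciding theorem `Theses.EtaLeadingQuarter.closes` of route `EtaLeadingQuarter` (case split on RH inside)
fed with that route's three landed items — `SecondMomentAFE.etaLeadingSecondMoment_proof` (21791,
p587396), `Locking.weakLockingLayer_proof` (21792), `Trial.quarterTrialVectors_proof` (21793).
The route decl `Theses.IntegerScrew.ScrewFloorLimsupQuarter` unfolds to the registered conjecture
`Theorems.IntegerScrew.ScrewFloorLimsupQuarter` by `rfl`.
Cell rh-split (typer glue).  Nothing here bears on the truth of RH.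
-/

set_option linter.dupNamespace false  -- the mandated namespace repeats `RiemannHypothesis`

namespace Summit.RiemannHypothesis.RiemannHypothesis.Theorems.IntegerScrew

open Summit.RiemannHypothesis.RiemannHypothesis.Theorems.EtaLeadingQuarter

/-- **THEOREM A holds**: `limsup_M screwFloor M ≤ 1/4` in `ε`-form — the registered conjecture
`ScrewFloorLimsupQuarter` is a theorem (route `EtaLeadingQuarter`'s `closes` applied to its three
proved items). [folklore] -/
theorem screwFloorLimsupQuarter_holds : ScrewFloorLimsupQuarter :=
  Summit.RiemannHypothesis.RiemannHypothesis.Theses.EtaLeadingQuarter.closes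
    SecondMomentAFE.etaLeadingSecondMoment_proof Locking.weakLockingLayer_proof
    Trial.quarterTrialVectors_proof

/-- **Item stmt-RiemannHypothesis-19328** (route `IntegerScrew`, decl `ScrewFloorLimsupQuarter`,
rung S-P(P1) leaf): the route statement holds. [folklore] -/
theorem screwFloorLimsupQuarter_proof :
    Summit.RiemannHypothesis.RiemannHypothesis.Theses.IntegerScrew.ScrewFloorLimsupQuarter :=
  screwFloorLimsupQuarter_holds

end Summit.RiemannHypothesis.RiemannHypothesis.Theorems.IntegerScrew
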